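import Mathlib
import HarnessLib
import Summits.NavierStokesRegularity.NavierStokesRegularity.Theorems.PoloidalWindowRigidity.Negative.LocalTHEmptyFalseWithoutSlopeGradient
import Summits.NavierStokesRegularity.NavierStokesRegularity.Theorems.PoloidalWindowDoorLrcModEntireTwistingTHLocalGalilean

/-!
# Crux `PoloidalWindowRigidity` (K2, stmt-NavierStokesRegularity-19708) / item `LrcModEntire` (20428) — negative side, sequel:
# the REGISTERED v4.2 normal form `stub_localTHEmptyHypNUG` is FALSE WITHOUT ITS SLOPE-GRADIENT CLAUSE `∂_z μ ≠ 0`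

Refuter seat ns-regularity-refuter1 (cell ns-regularity-ideate, D-0081 §C; brick K-56b), `--supports stmt-NavierStokesRegularity-19708`.
Sequel of `…Negative.LocalTHEmptyFalseWithoutSlopeGradient` (S1 and the v4.1 hyperbolic statement without `∂_zμ ≠ 0` are false, witness
the crossed suction layers `crossField 2 1 0` with constant slope `μ ≡ −1`).  The registered stub of `Cruxes/LrcModEntire/Lines/twist_split.lean`
v4.2 appends two FREE NORMALISATIONS at `p₀` — the non-umbilic pin `Φ₂(p₀) = (∂₀u₀ − ∂₁u₁, ∂₁u₀)(p₀) ≠ 0` and the Galilean rest frame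
`u(p₀) = 0` (K2-p2 g7 p585858 / p586459).  Neither interacts with the slope-gradient clause:

* `localTHEmptyHypNonUmbilic_of_galilean_noSlopeGradient` — K2-p2 g7's Galilean relocation
  `…TwistingTHLocalGalilean.localTHEmptyHypNonUmbilic_of_galilean` with the binder `deriv (μ p₀.1) (p₀.2 2) ≠ 0 →` deleted on both
  sides (proof copied verbatim minus that pin: the boost passes every point condition through unchanged);
* `localTHEmptyHypNUG_false_without_slopeGradient` — the text of `stub_localTHEmptyHypNUG` VERBATIM with the single clause
  `deriv (μ p₀.1) (p₀.2 2) ≠ 0 →` deleted is FALSE: relocate, then kill the pinned statement with the non-umbilic witness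
  `crossField 2 1 0` at the origin (`…LocalTHEmptyFalseWithoutSlopeGradient.CrossedLayers.crossField_localTHSystem`).

So in the normal form used by the certificate lanes (CERT-MEMO-4 §0) the pin `∂_zμ(p₀) ≠ 0` remains load-bearing: the sub-system
(TH) ∩ {μ_z(p₀) = 0} contains twisting, hyperbolic, non-umbilic exact Navier–Stokes germs in their rest frame.

WHAT THIS IS NOT: not a refutation of `stub_localTHEmptyHypNUG`, of the line, or of anything about Navier–Stokes regularity — a
kernel-checked certificate that the clause cannot be dropped from the registered statement either.
-/

noncomputable section
-- the summit and its single sub-problem share the name (CONVENTIONS §1), as in every Theorems file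
set_option linter.dupNamespace false

namespace Summit.NavierStokesRegularity.NavierStokesRegularity.Theorems.PoloidalWindowRigidity.Negative

open Set Function Filter Topology Metric
open scoped Laplacian RealInnerProductSpace InnerProductSpace
open Literature.Analysis Literature.Analysis.FluidPDE
open CrossedLayers

/-! ## Galilean relocation, clause by clause -/

section Galilean

open Summit.NavierStokesRegularity.NavierStokesRegularity.Theorems.PoloidalWindowDoorLrcModEntireJetLetters
open Summit.NavierStokesRegularity.NavierStokesRegularity.Theorems.PoloidalWindowDoorLrcModEntireTHCertLetters
open Summit.NavierStokesRegularity.NavierStokesRegularity.Theorems.PoloidalWindowDoorLrcModEntireTHCertDictionary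
open Summit.NavierStokesRegularity.NavierStokesRegularity.Theorems.PoloidalWindowDoorPoloidalWindowRigiditySlopeFunctionSource
open Summit.NavierStokesRegularity.NavierStokesRegularity.Theorems.PoloidalWindowDoorLrcModEntireTwistingTHLocalGalilean

/-- **GALILEAN RELOCATION WITHOUT THE SLOPE-GRADIENT CLAUSE** — K2-p2 g7's `…TwistingTHLocalGalilean.localTHEmptyHypNonUmbilic_of_galilean`
(p586459) with the binder `deriv (μ p₀.1) (p₀.2 2) ≠ 0 →` deleted on BOTH sides, proof copied verbatim minus that pin (the boost passes every
point condition through unchanged, so the relocation is clause-by-clause): the pinned hyperbolic statement without `∂_zμ ≠ 0` may still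
assume the rest frame `u(p₀) = 0`. [folklore] -/
theorem localTHEmptyHypNonUmbilic_of_galilean_noSlopeGradient
    (hG : ∀ (u : ℝ → EuclideanSpace ℝ (Fin 3) → EuclideanSpace ℝ (Fin 3)) (μ A : ℝ → ℝ → ℝ)
      (U : Set (ℝ × EuclideanSpace ℝ (Fin 3))) (p₀ : ℝ × EuclideanSpace ℝ (Fin 3)),
      IsOpen U → p₀ ∈ U →
      AnalyticOnNhd ℝ (Function.uncurry u) U →
      (∀ p ∈ U, AnalyticAt ℝ (Function.uncurry μ) (p.1, p.2 2)) →
      (∀ p ∈ U, AnalyticAt ℝ (Function.uncurry A) (p.1, p.2 2)) →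
      (∀ p ∈ U, fderiv ℝ (u p.1) p.2 (EuclideanSpace.single 0 1) 1 = fderiv ℝ (u p.1) p.2 (EuclideanSpace.single 1 1) 0) →
      (∀ p ∈ U, fderiv ℝ (u p.1) p.2 (EuclideanSpace.single 0 1) 0 + fderiv ℝ (u p.1) p.2 (EuclideanSpace.single 1 1) 1 +
        fderiv ℝ (u p.1) p.2 (EuclideanSpace.single 2 1) 2 = 0) →
      (∀ p ∈ U, ∀ b : Fin 3, b ≠ 2 →
        fderiv ℝ (u p.1) p.2 (EuclideanSpace.single 2 1) b =
          μ p.1 (p.2 2) * fderiv ℝ (u p.1) p.2 (EuclideanSpace.single b 1) 2) →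
      (∀ p ∈ U,
        (1 - μ p.1 (p.2 2)) *
            (deriv (fun s => u s p.2 2) p.1 + fderiv ℝ (fun y => u p.1 y 2) p.2 (u p.1 p.2)
              - Δ (fun y => u p.1 y 2) p.2) =
          A p.1 (p.2 2) + (deriv (fun s => μ s (p.2 2)) p.1 - deriv (deriv (μ p.1)) (p.2 2)) * u p.1 p.2 2
            + deriv (μ p.1) (p.2 2) / 2 * u p.1 p.2 2 ^ 2
            - 2 * deriv (μ p.1) (p.2 2) * fderiv ℝ (u p.1) p.2 (EuclideanSpace.single 2 1) 2) →
      fderiv ℝ (fun y => fderiv ℝ (u p₀.1) y (EuclideanSpace.single 2 1) 2) p₀.2 (EuclideanSpace.single 0 1) *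
            fderiv ℝ (u p₀.1) p₀.2 (EuclideanSpace.single 1 1) 2 -
          fderiv ℝ (fun y => fderiv ℝ (u p₀.1) y (EuclideanSpace.single 2 1) 2) p₀.2 (EuclideanSpace.single 1 1) *
            fderiv ℝ (u p₀.1) p₀.2 (EuclideanSpace.single 0 1) 2 ≠ 0 →
      μ p₀.1 (p₀.2 2) ≠ 0 → μ p₀.1 (p₀.2 2) ≠ 1 →
      μ p₀.1 (p₀.2 2) < 0 →
      (fderiv ℝ (u p₀.1) p₀.2 (EuclideanSpace.single 0 1) 0 ≠ fderiv ℝ (u p₀.1) p₀.2 (EuclideanSpace.single 1 1) 1 ∨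
        fderiv ℝ (u p₀.1) p₀.2 (EuclideanSpace.single 1 1) 0 ≠ 0) →
      u p₀.1 p₀.2 = 0 → False) :
    ∀ (u : ℝ → EuclideanSpace ℝ (Fin 3) → EuclideanSpace ℝ (Fin 3)) (μ A : ℝ → ℝ → ℝ)
      (U : Set (ℝ × EuclideanSpace ℝ (Fin 3))) (p₀ : ℝ × EuclideanSpace ℝ (Fin 3)),
      IsOpen U → p₀ ∈ U →
      AnalyticOnNhd ℝ (Function.uncurry u) U →
      (∀ p ∈ U, AnalyticAt ℝ (Function.uncurry μ) (p.1, p.2 2)) →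
      (∀ p ∈ U, AnalyticAt ℝ (Function.uncurry A) (p.1, p.2 2)) →
      (∀ p ∈ U, fderiv ℝ (u p.1) p.2 (EuclideanSpace.single 0 1) 1 = fderiv ℝ (u p.1) p.2 (EuclideanSpace.single 1 1) 0) →
      (∀ p ∈ U, fderiv ℝ (u p.1) p.2 (EuclideanSpace.single 0 1) 0 + fderiv ℝ (u p.1) p.2 (EuclideanSpace.single 1 1) 1 +
        fderiv ℝ (u p.1) p.2 (EuclideanSpace.single 2 1) 2 = 0) →
      (∀ p ∈ U, ∀ b : Fin 3, b ≠ 2 →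
        fderiv ℝ (u p.1) p.2 (EuclideanSpace.single 2 1) b =
          μ p.1 (p.2 2) * fderiv ℝ (u p.1) p.2 (EuclideanSpace.single b 1) 2) →
      (∀ p ∈ U,
        (1 - μ p.1 (p.2 2)) *
            (deriv (fun s => u s p.2 2) p.1 + fderiv ℝ (fun y => u p.1 y 2) p.2 (u p.1 p.2)
              - Δ (fun y => u p.1 y 2) p.2) =
          A p.1 (p.2 2) + (deriv (fun s => μ s (p.2 2)) p.1 - deriv (deriv (μ p.1)) (p.2 2)) * u p.1 p.2 2
            + deriv (μ p.1) (p.2 2) / 2 * u p.1 p.2 2 ^ 2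
            - 2 * deriv (μ p.1) (p.2 2) * fderiv ℝ (u p.1) p.2 (EuclideanSpace.single 2 1) 2) →
      fderiv ℝ (fun y => fderiv ℝ (u p₀.1) y (EuclideanSpace.single 2 1) 2) p₀.2 (EuclideanSpace.single 0 1) *
            fderiv ℝ (u p₀.1) p₀.2 (EuclideanSpace.single 1 1) 2 -
          fderiv ℝ (fun y => fderiv ℝ (u p₀.1) y (EuclideanSpace.single 2 1) 2) p₀.2 (EuclideanSpace.single 1 1) *
            fderiv ℝ (u p₀.1) p₀.2 (EuclideanSpace.single 0 1) 2 ≠ 0 →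
      μ p₀.1 (p₀.2 2) ≠ 0 → μ p₀.1 (p₀.2 2) ≠ 1 →
      μ p₀.1 (p₀.2 2) < 0 →
      (fderiv ℝ (u p₀.1) p₀.2 (EuclideanSpace.single 0 1) 0 ≠ fderiv ℝ (u p₀.1) p₀.2 (EuclideanSpace.single 1 1) 1 ∨
        fderiv ℝ (u p₀.1) p₀.2 (EuclideanSpace.single 1 1) 0 ≠ 0) → False := by
  intro u μ A U p₀ hU hp₀ hu hμ hA hpol hdiv hsh hE htw hm0 hm1 hneg hNU
  obtain ⟨t₀, x₀⟩ := p₀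
  set c : EuclideanSpace ℝ (Fin 3) := u t₀ x₀ with hc
  -- the shear and the boosted datum
  set τ : ℝ × EuclideanSpace ℝ (Fin 3) → ℝ × EuclideanSpace ℝ (Fin 3) := fun p => (p.1, p.2 + (p.1 - t₀) • c) with hτ
  set u' : ℝ → EuclideanSpace ℝ (Fin 3) → EuclideanSpace ℝ (Fin 3) := fun s z => u s (z + (s - t₀) • c) - c with hu'
  set μ' : ℝ → ℝ → ℝ := fun s ζ => μ s (ζ + (s - t₀) * c 2) with hμ'
  set A' : ℝ → ℝ → ℝ := fun s ζ => A s (ζ + (s - t₀) * c 2) +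
      c 2 * (jetLetter (uncurry μ) (word2 1 0) (s, ζ + (s - t₀) * c 2) -
        jetLetter (uncurry μ) (word2 0 2) (s, ζ + (s - t₀) * c 2)) +
      c 2 ^ 2 / 2 * jetLetter (uncurry μ) (word2 0 1) (s, ζ + (s - t₀) * c 2) with hA'
  set U' : Set (ℝ × EuclideanSpace ℝ (Fin 3)) := τ ⁻¹' U with hU'
  have hτc : Continuous τ := by rw [hτ]; fun_prop
  have hτa : ∀ p, AnalyticAt ℝ τ p := fun p => by
    rw [hτ]
    exact analyticAt_fst.prod (analyticAt_snd.add ((analyticAt_fst.sub analyticAt_const).smul analyticAt_const))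
  have hτ2 : ∀ p : ℝ × EuclideanSpace ℝ (Fin 3), ((τ p).1, (τ p).2 2) = (p.1, p.2 2 + (p.1 - t₀) * c 2) := fun p => by
    rw [hτ]; simp
  -- the shear on shadows
  have hsha : ∀ q : ℝ × ℝ, AnalyticAt ℝ (fun q : ℝ × ℝ => ((q.1, q.2 + (q.1 - t₀) * c 2) : ℝ × ℝ)) q := fun q =>
    analyticAt_fst.prod (analyticAt_snd.add ((analyticAt_fst.sub analyticAt_const).mul analyticAt_const))
  have hU'o : IsOpen U' := hU.preimage hτc
  have hτ₀ : τ (t₀, x₀) = (t₀, x₀) := by rw [hτ]; simp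
  have hp₀' : ((t₀, x₀) : ℝ × EuclideanSpace ℝ (Fin 3)) ∈ U' := by
    show τ (t₀, x₀) ∈ U; rw [hτ₀]; exact hp₀
  -- analyticity of the boosted datum
  have hu'a : AnalyticOnNhd ℝ (uncurry u') U' := by
    intro p hp
    have h := ((hu (τ p) hp).comp (hτa p)).sub (analyticAt_const (v := c))
    refine h.congr (Eventually.of_forall fun q => ?_)
    obtain ⟨s, z⟩ := q; rfl
  have hμ'a : ∀ p ∈ U', AnalyticAt ℝ (uncurry μ') (p.1, p.2 2) := by
    intro p hp
    have h1 : AnalyticAt ℝ (uncurry μ) (p.1, p.2 2 + (p.1 - t₀) * c 2) := by rw [← hτ2]; exact hμ (τ p) hp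
    have h := AnalyticAt.comp (f := fun q : ℝ × ℝ => ((q.1, q.2 + (q.1 - t₀) * c 2) : ℝ × ℝ)) (x := (p.1, p.2 2))
      h1 (hsha (p.1, p.2 2))
    refine h.congr (Eventually.of_forall fun q => ?_)
    obtain ⟨s, ζ⟩ := q; rfl
  have hA'a : ∀ p ∈ U', AnalyticAt ℝ (uncurry A') (p.1, p.2 2) := by
    intro p hp
    have hm : ((p.1, p.2 2 + (p.1 - t₀) * c 2) : ℝ × ℝ) ∈ analyticSet μ := by
      show AnalyticAt ℝ (uncurry μ) _; rw [← hτ2]; exact hμ (τ p) hp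
    have hJ : ∀ w, AnalyticAt ℝ (fun q : ℝ × ℝ => jetLetter (uncurry μ) w (q.1, q.2 + (q.1 - t₀) * c 2)) (p.1, p.2 2) :=
      fun w => AnalyticAt.comp (f := fun q : ℝ × ℝ => ((q.1, q.2 + (q.1 - t₀) * c 2) : ℝ × ℝ)) (x := (p.1, p.2 2))
        (analyticOnNhd_jetLetter (analyticOnNhd_analyticSet μ) w _ hm) (hsha (p.1, p.2 2))
    have hA1 : AnalyticAt ℝ (fun q : ℝ × ℝ => A q.1 (q.2 + (q.1 - t₀) * c 2)) (p.1, p.2 2) := by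
      have h1 : AnalyticAt ℝ (uncurry A) (p.1, p.2 2 + (p.1 - t₀) * c 2) := by rw [← hτ2]; exact hA (τ p) hp
      have h := AnalyticAt.comp (f := fun q : ℝ × ℝ => ((q.1, q.2 + (q.1 - t₀) * c 2) : ℝ × ℝ)) (x := (p.1, p.2 2))
        h1 (hsha (p.1, p.2 2))
      refine h.congr (Eventually.of_forall fun q => ?_)
      obtain ⟨s, ζ⟩ := q; rfl
    have h := (hA1.add ((analyticAt_const (v := c 2)).mul ((hJ (word2 1 0)).sub (hJ (word2 0 2))))).add
      ((analyticAt_const (v := c 2 ^ 2 / 2)).mul (hJ (word2 0 1)))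
    refine h.congr (Eventually.of_forall fun q => ?_)
    obtain ⟨s, ζ⟩ := q; rfl
  -- the kinematic identities transfer pointwise through the translated jets
  have hent : ∀ p : ℝ × EuclideanSpace ℝ (Fin 3), ∀ e : EuclideanSpace ℝ (Fin 3), ∀ i : Fin 3,
      fderiv ℝ (u' p.1) p.2 e i = fderiv ℝ (u (τ p).1) (τ p).2 e i := fun p e i => by
    rw [hu', hτ]; dsimp only; rw [fderiv_boost]
  have hslope : ∀ p : ℝ × EuclideanSpace ℝ (Fin 3), μ' p.1 (p.2 2) = μ (τ p).1 ((τ p).2 2) := fun p => by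
    rw [hμ', hτ]; simp
  have hpol' : ∀ p ∈ U', fderiv ℝ (u' p.1) p.2 (EuclideanSpace.single 0 1) 1 =
      fderiv ℝ (u' p.1) p.2 (EuclideanSpace.single 1 1) 0 := fun p hp => by
    rw [hent, hent]; exact hpol (τ p) hp
  have hdiv' : ∀ p ∈ U', fderiv ℝ (u' p.1) p.2 (EuclideanSpace.single 0 1) 0 +
      fderiv ℝ (u' p.1) p.2 (EuclideanSpace.single 1 1) 1 + fderiv ℝ (u' p.1) p.2 (EuclideanSpace.single 2 1) 2 = 0 :=
    fun p hp => by rw [hent, hent, hent]; exact hdiv (τ p) hp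
  have hsh' : ∀ p ∈ U', ∀ b : Fin 3, b ≠ 2 → fderiv ℝ (u' p.1) p.2 (EuclideanSpace.single 2 1) b =
      μ' p.1 (p.2 2) * fderiv ℝ (u' p.1) p.2 (EuclideanSpace.single b 1) 2 := fun p hp b hb => by
    rw [hent, hent, hslope]; exact hsh (τ p) hp b hb
  -- the scalar law transfers by Galilean covariance
  have hE' : ∀ p ∈ U',
      (1 - μ' p.1 (p.2 2)) *
          (deriv (fun s => u' s p.2 2) p.1 + fderiv ℝ (fun y => u' p.1 y 2) p.2 (u' p.1 p.2)
            - Δ (fun y => u' p.1 y 2) p.2) =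
        A' p.1 (p.2 2) + (deriv (fun s => μ' s (p.2 2)) p.1 - deriv (deriv (μ' p.1)) (p.2 2)) * u' p.1 p.2 2
          + deriv (μ' p.1) (p.2 2) / 2 * u' p.1 p.2 2 ^ 2
          - 2 * deriv (μ' p.1) (p.2 2) * fderiv ℝ (u' p.1) p.2 (EuclideanSpace.single 2 1) 2 := by
    intro p hp
    obtain ⟨t, y⟩ := p
    have hq : ((t, y + (t - t₀) • c) : ℝ × EuclideanSpace ℝ (Fin 3)) ∈ U := hp
    have hEq := hE _ hq
    dsimp only at hEq
    have h10 := letterFn_M10 (u := u) (A := A) hμ hq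
    have h01 := letterFn_M01 (u := u) (A := A) hμ hq
    have h02 := letterFn_M02 (u := u) (A := A) hμ hq
    simp only [letterFn, shear_apply_two] at h10 h01 h02
    have hG := galilean_E (A := A) hu hμ t₀ c hq hEq
    rw [hu', hμ', hA']
    dsimp only
    rw [h10, h01, h02]
    exact hG
  -- the pins at `p₀` are unchanged and `u′(p₀) = 0`
  have hent₀ : ∀ e : EuclideanSpace ℝ (Fin 3), ∀ i : Fin 3, fderiv ℝ (u' t₀) x₀ e i = fderiv ℝ (u t₀) x₀ e i :=
    fun e i => by have h := hent (t₀, x₀) e i; rwa [hτ₀] at h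
  have hent2₀ : ∀ e : EuclideanSpace ℝ (Fin 3),
      fderiv ℝ (fun y => fderiv ℝ (u' t₀) y (EuclideanSpace.single 2 1) 2) x₀ e =
        fderiv ℝ (fun y => fderiv ℝ (u t₀) y (EuclideanSpace.single 2 1) 2) x₀ e := fun e => by
    rw [hu']; dsimp only; rw [fderiv_fderiv_boost]; simp
  have hsl₀ : μ' t₀ (x₀ 2) = μ t₀ (x₀ 2) := by rw [hμ']; simp
  have hrest : u' t₀ x₀ = 0 := by rw [hu']; simp [hc]
  refine hG u' μ' A' U' (t₀, x₀) hU'o hp₀' hu'a hμ'a hA'a hpol' hdiv' hsh' hE' ?_ ?_ ?_ ?_ ?_ hrest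
  · simp only [hent₀, hent2₀]; exact htw
  · simp only [hsl₀]; exact hm0
  · simp only [hsl₀]; exact hm1
  · simp only [hsl₀]; exact hneg
  · simp only [hent₀]; exact hNU

end Galilean

/-- **S1-HypNUG (v4.2, the REGISTERED stub of item 20428) WITHOUT `∂_z μ ≠ 0` IS FALSE.**  The negated statement is the text of
`stub_localTHEmptyHypNUG` (`Cruxes/LrcModEntire/Lines/twist_split.lean` v4.2 = K2-p2 g7's `hG`/`hemptyHypNUG`) VERBATIM with the point
clause `deriv (μ p₀.1) (p₀.2 2) ≠ 0 →` deleted — hyperbolicity `μ < 0`, the non-umbilic pin `Φ₂(p₀) ≠ 0` and the Galilean rest frame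
`u(p₀) = 0` all KEPT.  Proof: the clause-free Galilean relocation above reduces it to the pinned statement without rest frame, which
the crossed layers `crossField 2 1 0` kill at the origin (twist `−1`, `μ ≡ −1 < 0`, `∂₀u₀ = −1 ≠ −½ = ∂₁u₁`).  So the two free
normalisations of v4.2 do not interact with the slope-gradient clause: it stays load-bearing in the normal form. [folklore] -/
theorem localTHEmptyHypNUG_false_without_slopeGradient :
    ¬ (∀ (u : ℝ → EuclideanSpace ℝ (Fin 3) → EuclideanSpace ℝ (Fin 3)) (μ A : ℝ → ℝ → ℝ)
        (U : Set (ℝ × EuclideanSpace ℝ (Fin 3))) (p₀ : ℝ × EuclideanSpace ℝ (Fin 3)),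
        IsOpen U → p₀ ∈ U →
        AnalyticOnNhd ℝ (Function.uncurry u) U →
        (∀ p ∈ U, AnalyticAt ℝ (Function.uncurry μ) (p.1, p.2 2)) →
        (∀ p ∈ U, AnalyticAt ℝ (Function.uncurry A) (p.1, p.2 2)) →
        (∀ p ∈ U, fderiv ℝ (u p.1) p.2 (EuclideanSpace.single 0 1) 1 = fderiv ℝ (u p.1) p.2 (EuclideanSpace.single 1 1) 0) →
        (∀ p ∈ U, fderiv ℝ (u p.1) p.2 (EuclideanSpace.single 0 1) 0 + fderiv ℝ (u p.1) p.2 (EuclideanSpace.single 1 1) 1 +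
          fderiv ℝ (u p.1) p.2 (EuclideanSpace.single 2 1) 2 = 0) →
        (∀ p ∈ U, ∀ b : Fin 3, b ≠ 2 →
          fderiv ℝ (u p.1) p.2 (EuclideanSpace.single 2 1) b =
            μ p.1 (p.2 2) * fderiv ℝ (u p.1) p.2 (EuclideanSpace.single b 1) 2) →
        (∀ p ∈ U,
          (1 - μ p.1 (p.2 2)) *
              (deriv (fun s => u s p.2 2) p.1 + fderiv ℝ (fun y => u p.1 y 2) p.2 (u p.1 p.2)
                - Δ (fun y => u p.1 y 2) p.2) =
            A p.1 (p.2 2) + (deriv (fun s => μ s (p.2 2)) p.1 - deriv (deriv (μ p.1)) (p.2 2)) * u p.1 p.2 2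
              + deriv (μ p.1) (p.2 2) / 2 * u p.1 p.2 2 ^ 2
              - 2 * deriv (μ p.1) (p.2 2) * fderiv ℝ (u p.1) p.2 (EuclideanSpace.single 2 1) 2) →
        fderiv ℝ (fun y => fderiv ℝ (u p₀.1) y (EuclideanSpace.single 2 1) 2) p₀.2 (EuclideanSpace.single 0 1) *
              fderiv ℝ (u p₀.1) p₀.2 (EuclideanSpace.single 1 1) 2 -
            fderiv ℝ (fun y => fderiv ℝ (u p₀.1) y (EuclideanSpace.single 2 1) 2) p₀.2 (EuclideanSpace.single 1 1) *
              fderiv ℝ (u p₀.1) p₀.2 (EuclideanSpace.single 0 1) 2 ≠ 0 →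
        μ p₀.1 (p₀.2 2) ≠ 0 → μ p₀.1 (p₀.2 2) ≠ 1 →
        μ p₀.1 (p₀.2 2) < 0 →
        (fderiv ℝ (u p₀.1) p₀.2 (EuclideanSpace.single 0 1) 0 ≠ fderiv ℝ (u p₀.1) p₀.2 (EuclideanSpace.single 1 1) 1 ∨
          fderiv ℝ (u p₀.1) p₀.2 (EuclideanSpace.single 1 1) 0 ≠ 0) →
        u p₀.1 p₀.2 = 0 → False) := by
  intro hG
  have hNU := localTHEmptyHypNonUmbilic_of_galilean_noSlopeGradient hG
  obtain ⟨u, μ, A, U, p₀, hU, hp₀, hu, hμ, hA, hpol, hdiv, hshear, hE, htw, hμ0, hμ1, hμneg, hpin, -⟩ :=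
    crossField_localTHSystem
  exact hNU u μ A U p₀ hU hp₀ hu hμ hA hpol hdiv hshear hE htw hμ0 hμ1 hμneg hpin

end Summit.NavierStokesRegularity.NavierStokesRegularity.Theorems.PoloidalWindowRigidity.Negative

end
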